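import Summits.CriticalPhenomena.PercolationContinuityZ3.Theorems.PercNearOneGluingNoHeavyLowerTailKNGoodHubStar
import HarnessLib

/-!
# The gluing inequality GC when one of the two pendant children has a SINGLE port (any relay core)
# (`NoHeavyLowerTail` cell, stmt-CriticalPhenomena-4575; prover `prim-hp-2`, deletion–contraction line, gen 4)

Support file (`--supports stmt-CriticalPhenomena-4575`).  No definitions, no named facts, no sorries.
Setting of `KNGoodSeries.knGood_series_of_gluing`: `u = G − o`, children `x ≠ y ∉ A` of `o`, `a₀ ∈ argmin_A P_u(· ↔ b)`, `u* = u[s(x,y) ↦ 1]`,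
GC = `agood(u*, x; a₀) ≥ 0`.  Here `x` is a pendant relay-star with a SINGLE port `p ∈ A` (its only possibly-positive pair in `u`) and `y` is an
arbitrary pendant relay-star; the core is ARBITRARY.  Proof ("affinity in the single hair"): `h ↦ agood(u*[xp ↦ h], x; a₀)` is affine
(`KNGoodSeries.agood_affine_pair`); at `h = 1` the argmin survives gluing `x` into `p` (`KNGoodHair.glueTransfer_openConn`) and then `y` into
`x`, so the value is `≥` the pocket term `≥ 0`; at `h = 0` the vertex `x` is isolated, the twins swap (`KNGoodPortFree.agood_swap_glued`), `y`
is good by Kozma–Nitzan's Theorems 5 + 4, and `a₀` is still a minimiser because the weight of a pendant vertex's unique pair never changes the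
connection probabilities of other vertices (`real_openConn_update_pendant`).

* `KNGoodSinglePort.real_openConn_update_pendant` — if all pairs at `x` other than `s(x,p)` have weight `0`, then `P_{w[xp↦t]}(v ↔ b)` does not
  depend on `t` for `v, b ≠ x`.
* `KNGoodSinglePort.gc_of_singlePort` — GC in the setting above.
* `KNGoodSinglePort.knGood_twoStars_singlePort` — **goodness for `o` + relay hairs + a single-port pendant child `x` + an arbitrary pendant star `y`
  on an ARBITRARY core** (both children may be lonelier than every relay).
-/

noncomputable section

namespace Summit.CriticalPhenomena.PercolationContinuityZ3.Theorems

open MeasureTheory Set Literature.Probability.LatticeModels Literature.Probability.Percolation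
open scoped Classical BigOperators

variable {n : ℕ}

namespace KNGoodSinglePort

open ChampionStability KNGoodAux KNGoodHair RelayNbhd CILTwoSteiner KNGoodSeries KNGoodSeriesEasy KNGoodLoser KNGoodPortFree KNGoodHubStar

/-- **A pendant vertex's unique pair does not matter to others.**  If every pair at `x` other than `s(x,p)` has weight `0` (`p ≠ x`), then for
`v, b ≠ x` the probability of `v ↔ b` is the same under `w[s(x,p) ↦ t]` for every `t`. [folklore] -/
theorem real_openConn_update_pendant (w : Sym2 (Fin n) → unitInterval) (x p v b : Fin n) (hpx : p ≠ x) (hvx : v ≠ x) (hbx : b ≠ x)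
    (hpend : ∀ z : Fin n, z ≠ x → z ≠ p → w s(x, z) = 0) (t t' : unitInterval) :
    (prodBernoulli (Function.update w s(x, p) t)).real (openConn v b) =
      (prodBernoulli (Function.update w s(x, p) t')).real (openConn v b) := by
  haveI : ∀ u : Sym2 (Fin n) → unitInterval, IsProbabilityMeasure (prodBernoulli u) := fun u => inferInstance
  set e : Sym2 (Fin n) := s(x, p) with he
  set μ0 := prodBernoulli (Function.update w e 0) with hμ0
  have hdec : ∀ (u : unitInterval) (S : Set (BondConfig (Fin n))),
      (prodBernoulli (Function.update w e u)).real S =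
        (1 - (u : ℝ)) * μ0.real S + (u : ℝ) * (prodBernoulli (Function.update w e 1)).real S := by
    intro u S
    have h := stub_oneBondDecomp_k15 n (Function.update w e u) e S
    rwa [Function.update_idem, Function.update_idem, Function.update_self] at h
  -- key: μ_{w[e↦1]}(v ↔ b) = μ_{w[e↦0]}(v ↔ b)
  have hkey : (prodBernoulli (Function.update w e 1)).real (openConn v b) = μ0.real (openConn v b) := by
    have h1 : (prodBernoulli (Function.update w e 1)).real (openConn v b) =
        μ0.real ((fun ω : BondConfig (Fin n) => insert e ω) ⁻¹' (openConn v b)) := by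
      rw [hμ0, ← tieLiftTwo_real_update_one (Function.update w e 0) e, Function.update_idem]
    rw [h1]
    -- the set where `x` is isolated is almost sure under `μ0`, and there the two events agree
    set F : Finset (Sym2 (Fin n)) := ((Finset.univ : Finset (Fin n)).filter (fun z => z ≠ x)).image (fun z => s(x, z)) with hF
    have hN : μ0 {ω : BondConfig (Fin n) | ∃ f ∈ F, f ∈ ω} = 0 := by
      refine prodBernoulli_setOf_exists_mem_eq_zero (Function.update w e 0) F fun f hf => ?_
      obtain ⟨z, hz, rfl⟩ := Finset.mem_image.1 hf
      have hzx : z ≠ x := (Finset.mem_filter.1 hz).2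
      by_cases hzp : z = p
      · rw [hzp, ← he, Function.update_self]; rfl
      · have hne : s(x, z) ≠ e := by rw [he]; exact fun h => hzp (Sym2.congr_right.1 h)
        rw [Function.update_of_ne hne, hpend z hzx hzp]; rfl
    have hZ : μ0.real ({ω : BondConfig (Fin n) | ∀ f ∈ F, f ∉ ω}ᶜ) = 0 := by
      have : ({ω : BondConfig (Fin n) | ∀ f ∈ F, f ∉ ω}ᶜ) = {ω : BondConfig (Fin n) | ∃ f ∈ F, f ∈ ω} := by
        ext ω; simp only [mem_compl_iff, mem_setOf_eq, not_forall, not_not, exists_prop]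
      rw [this, measureReal_def, hN, ENNReal.toReal_zero]
    refine measureReal_congr_of_null μ0 _ _ {ω : BondConfig (Fin n) | ∀ f ∈ F, f ∉ ω} hZ ?_
    ext ω
    simp only [mem_inter_iff, mem_preimage, mem_setOf_eq]
    constructor
    · rintro ⟨hω, hiso⟩
      refine ⟨?_, hiso⟩
      have hiso' : ∀ z : Fin n, z ≠ x → s(x, z) ∉ ω := fun z hz =>
        hiso s(x, z) (Finset.mem_image.2 ⟨z, Finset.mem_filter.2 ⟨Finset.mem_univ _, hz⟩, rfl⟩)
      have hvb : (openGraph (insert s(x, p) ω)).Reachable v b := hω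
      rw [reachable_insert_iff ω (Ne.symm hpx)] at hvb
      rcases hvb with h | ⟨⟨s₁, hs₁, hvs⟩, ⟨s₂, hs₂, hsb⟩⟩
      · exact h
      · simp only [Finset.mem_insert, Finset.mem_singleton] at hs₁ hs₂
        have hvx' : ¬ (openGraph ω).Reachable v x := fun h => hvx (eq_of_reachable_of_isolated hiso' h.symm)
        have hxb' : ¬ (openGraph ω).Reachable x b := fun h => hbx (eq_of_reachable_of_isolated hiso' h)
        rcases hs₁ with h₁ | h₁
        · rw [h₁] at hvs; exact absurd hvs hvx'
        · rcases hs₂ with h₂ | h₂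
          · rw [h₂] at hsb; exact absurd hsb hxb'
          · rw [h₁] at hvs; rw [h₂] at hsb; exact hvs.trans hsb
    · rintro ⟨hω, hiso⟩
      exact ⟨(show (openGraph ω).Reachable v b from hω).mono (openGraph_mono (subset_insert _ _)), hiso⟩
  rw [hdec t, hdec t', hkey]; ring

/-- **GC when the child `x` has a single port** (`p ∈ A`; `y` an arbitrary pendant relay-star; arbitrary core).  With `u* = u[s(x,y) ↦ 1]` and `a₀` a
minimiser of `P_u(· ↔ b)` over `A`: `agood(u*, x; a₀) ≥ 0`. [cite: KozmaNitzan2024, Thm. 4 (p. 12), Thm. 5 (p. 13), Lemma 5 (p. 13) — extension] -/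
theorem gc_of_singlePort (u : Sym2 (Fin n) → unitInterval) (A : Finset (Fin n)) (hA : A.Nonempty)
    (x y p a₀ b : Fin n) (hx : x ∉ A) (hy : y ∉ A) (hxy : x ≠ y) (hp : p ∈ A) (ha₀ : a₀ ∈ A) (hbx : b ≠ x) (hby : b ≠ y)
    (hxpend : ∀ z : Fin n, z ≠ x → z ≠ p → u s(x, z) = 0)
    (hyN : ∀ z : Fin n, z ≠ y → z ∉ A → u s(y, z) = 0)
    (hmin : ∀ a' ∈ A, (prodBernoulli u).real (openConn a₀ b) ≤ (prodBernoulli u).real (openConn a' b)) :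
    0 ≤ (prodBernoulli (Function.update u s(x, y) 1)).real (openConn x b) -
        (prodBernoulli (Function.update u s(x, y) 1)).real (openConn a₀ b) +
        ∑ W ∈ nullSets A, (prodBernoulli (Function.update u s(x, y) 1)).real (clusterIs x W) *
          A.inf' hA (fun a' => (prodBernoulli (Function.update u s(x, y) 1)).real (openConnIn ((↑W : Set (Fin n))ᶜ) a' b)) := by
  haveI : ∀ v : Sym2 (Fin n) → unitInterval, IsProbabilityMeasure (prodBernoulli v) := fun v => inferInstance
  set us := Function.update u s(x, y) 1 with hus
  have hpx : p ≠ x := fun h => hx (h ▸ hp)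
  have hpa : x ≠ a₀ := fun h => hx (h ▸ ha₀)
  have hya : y ≠ a₀ := fun h => hy (h ▸ ha₀)
  have hpy : p ≠ y := fun h => hy (h ▸ hp)
  have hne : s(x, y) ≠ s(x, p) := fun h => hpy (Sym2.congr_right.1 h).symm
  -- affinity in the single hair `s(x,p)`
  have haff := agood_affine_pair us A hA x p a₀ b (us s(x, p))
  rw [Function.update_eq_self] at haff
  rw [haff]
  have h0p : 0 ≤ (us s(x, p) : ℝ) := (us s(x, p)).2.1
  have h1p : (us s(x, p) : ℝ) ≤ 1 := (us s(x, p)).2.2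
  -- value at `h = 1`: glue `x` into `p`, then `y` into `x`; the argmin survives both
  have hD1 : 0 ≤ ∑ W ∈ nullSets A, (prodBernoulli (Function.update us s(x, p) 1)).real (clusterIs x W) *
      A.inf' hA (fun a' => (prodBernoulli (Function.update us s(x, p) 1)).real (openConnIn ((↑W : Set (Fin n))ᶜ) a' b)) := by
    refine Finset.sum_nonneg fun W _ => mul_nonneg measureReal_nonneg ?_
    exact (Finset.le_inf'_iff hA _).2 fun a _ => measureReal_nonneg
  have hval1 : (prodBernoulli (Function.update us s(x, p) 1)).real (openConn a₀ b) ≤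
      (prodBernoulli (Function.update us s(x, p) 1)).real (openConn x b) := by
    have hcomm : Function.update us s(x, p) 1 = Function.update (Function.update u s(x, p) 1) s(x, y) 1 := by
      rw [hus, Function.update_comm hne]
    rw [hcomm]
    have h1 : (prodBernoulli (Function.update u s(x, p) 1)).real (openConn a₀ b) ≤
        (prodBernoulli (Function.update u s(x, p) 1)).real (openConn x b) :=
      glueTransfer_openConn u x p a₀ b (Ne.symm hpx) (hmin p hp)
    have h2 := glueTransfer_openConn (Function.update u s(x, p) 1) y x a₀ b (Ne.symm hxy) h1
    rw [show s(y, x) = s(x, y) from Sym2.eq_swap] at h2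
    rw [← real_openConn_update_one_glued (Function.update u s(x, p) 1) x y b hxy]
    exact h2
  -- value at `h = 0`: `x` isolated (glued to `y` only); swap twins, goodness of `y` by Thm 5 + Thm 4, and `a₀` still a minimiser
  set u0 := Function.update us s(x, p) 0 with hu0
  have hglue0 : u0 s(x, y) = 1 := by rw [hu0, Function.update_of_ne hne, hus, Function.update_self]
  have hu0x : ∀ z : Fin n, z ≠ x → z ≠ y → u0 s(x, z) = 0 := by
    intro z hzx hzy
    by_cases hzp : z = p
    · rw [hzp, hu0, Function.update_self]
    · have h1 : s(x, z) ≠ s(x, p) := fun h => hzp (Sym2.congr_right.1 h)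
      have h2 : s(x, z) ≠ s(x, y) := fun h => hzy (Sym2.congr_right.1 h)
      rw [hu0, Function.update_of_ne h1, hus, Function.update_of_ne h2]
      exact hxpend z hzx hzp
  have hu0y : ∀ z : Fin n, z ≠ y → z ≠ x → u0 s(y, z) = u s(y, z) := by
    intro z hzy hzx
    have h1 : s(y, z) ≠ s(x, p) := by
      intro h; rcases Sym2.eq_iff.1 h with ⟨h3, -⟩ | ⟨-, h3⟩
      · exact hxy h3.symm
      · exact hzx h3
    have h2 : s(y, z) ≠ s(x, y) := by
      intro h; rcases Sym2.eq_iff.1 h with ⟨h3, -⟩ | ⟨-, h3⟩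
      · exact hxy h3.symm
      · exact hzx h3
    rw [hu0, Function.update_of_ne h1, hus, Function.update_of_ne h2]
  have hgood0 : KNGood u0 A hA y b := by
    refine KozmaNitzan2024_thm5 u0 A hA y b x hy hby hxy (fun z hzy hzA hzx => ?_) ?_
    · rw [hu0y z hzy hzx]; exact hyN z hzy hzA
    · refine KozmaNitzan2024_thm4_good (restrW ({y}ᶜ : Set (Fin n)) u0) A hA x b hx fun z hzx _ => ?_
      by_cases hzy : z = y
      · rw [hzy]
        refine restrW_apply_of_not_mem u0 fun hmem => ?_
        exact (hmem.1 y (Sym2.mem_mk_right x y)) rfl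
      · exact le_antisymm ((restrW_le _ u0 s(x, z)).trans (le_of_eq (hu0x z hzx hzy))) bot_le
  -- relays: connection probabilities under `u0` equal those under `u`
  have hrel : ∀ v ∈ A, (prodBernoulli u0).real (openConn v b) = (prodBernoulli u).real (openConn v b) := by
    intro v hv
    have hvx : v ≠ x := fun h => hx (h ▸ hv)
    have hvy : v ≠ y := fun h => hy (h ▸ hv)
    -- u0 = (u[xp ↦ 0])[xy ↦ 1]; both coordinates are pairs at the (pendant / isolated) vertex x
    have hA1 : (prodBernoulli u0).real (openConn v b) = (prodBernoulli (Function.update u s(x, p) 0)).real (openConn v b) := by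
      have hcomm : u0 = Function.update (Function.update u s(x, p) 0) s(x, y) 1 := by rw [hu0, hus, Function.update_comm hne]
      rw [hcomm]
      have h := real_openConn_update_pendant (Function.update u s(x, p) 0) x y v b (Ne.symm hxy) hvx hbx ?_ 1 ((Function.update u s(x, p) 0) s(x, y))
      · rw [Function.update_eq_self] at h; exact h
      · intro z hzx hzy
        by_cases hzp : z = p
        · rw [hzp, Function.update_self]
        · have h1 : s(x, z) ≠ s(x, p) := fun h => hzp (Sym2.congr_right.1 h)
          rw [Function.update_of_ne h1]; exact hxpend z hzx hzp
    have hA2 : (prodBernoulli (Function.update u s(x, p) 0)).real (openConn v b) = (prodBernoulli u).real (openConn v b) := by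
      have h := real_openConn_update_pendant u x p v b hpx hvx hbx hxpend 0 (u s(x, p))
      rw [Function.update_eq_self] at h; exact h
    rw [hA1, hA2]
  have hmin0 : ∀ a' ∈ A, (prodBernoulli u0).real (openConn a₀ b) ≤ (prodBernoulli u0).real (openConn a' b) := by
    intro a' ha'; rw [hrel a₀ ha₀, hrel a' ha']; exact hmin a' ha'
  have hval0 : 0 ≤ (prodBernoulli u0).real (openConn x b) - (prodBernoulli u0).real (openConn a₀ b) +
      ∑ W ∈ nullSets A, (prodBernoulli u0).real (clusterIs x W) *
        A.inf' hA (fun a' => (prodBernoulli u0).real (openConnIn ((↑W : Set (Fin n))ᶜ) a' b)) := by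
    rw [agood_swap_glued u0 A hA x y a₀ b hxy hglue0]
    have hg := hgood0
    rw [KNGood] at hg
    have hle : (prodBernoulli u0).real (openConn a₀ b) ≤ A.inf' hA (fun a' => (prodBernoulli u0).real (openConn a' b)) :=
      (Finset.le_inf'_iff hA _).2 hmin0
    linarith
  have t1 : 0 ≤ (1 - (us s(x, p) : ℝ)) * ((prodBernoulli u0).real (openConn x b) - (prodBernoulli u0).real (openConn a₀ b) +
      ∑ W ∈ nullSets A, (prodBernoulli u0).real (clusterIs x W) *
        A.inf' hA (fun a' => (prodBernoulli u0).real (openConnIn ((↑W : Set (Fin n))ᶜ) a' b))) :=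
    mul_nonneg (by linarith) hval0
  have t2 : 0 ≤ (us s(x, p) : ℝ) * ((prodBernoulli (Function.update us s(x, p) 1)).real (openConn x b) -
      (prodBernoulli (Function.update us s(x, p) 1)).real (openConn a₀ b) +
      ∑ W ∈ nullSets A, (prodBernoulli (Function.update us s(x, p) 1)).real (clusterIs x W) *
        A.inf' hA (fun a' => (prodBernoulli (Function.update us s(x, p) 1)).real (openConnIn ((↑W : Set (Fin n))ᶜ) a' b))) :=
    mul_nonneg h0p (by linarith)
  linarith

/-- **Goodness for an observer with relay hairs, a SINGLE-PORT pendant child and an arbitrary pendant relay-star, on an arbitrary core.**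
`o ∉ A`; `x ≠ y` not in `A`, `≠ o`, not adjacent; `b ∉ {o, x, y}`; positive pairs at `o` go into `A ∪ {x, y}`; `x`'s only possibly-positive
pairs are `s(x,o)` and `s(x,p)` for one relay `p ∈ A`; positive pairs at `y` go into `A ∪ {o}`; the rest of the graph is arbitrary.  Then
`(G, A, o, b)` is good (Kozma–Nitzan), hence their (2) at `o` (`KNGood.preFKG2`) — with both children allowed to be lonelier than every relay.
[cite: KozmaNitzan2024, Thm. 4 (p. 12), Thm. 5 (p. 13) — extension] -/
theorem knGood_twoStars_singlePort (w : Sym2 (Fin n) → unitInterval) (A : Finset (Fin n)) (hA : A.Nonempty)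
    (o x y p b : Fin n) (ho : o ∉ A) (hx : x ∉ A) (hy : y ∉ A) (hxo : x ≠ o) (hyo : y ≠ o) (hxy : x ≠ y)
    (hbo : b ≠ o) (hbx : b ≠ x) (hby : b ≠ y) (hp : p ∈ A)
    (hoN : ∀ v : Fin n, v ≠ o → v ∉ A → v ≠ x → v ≠ y → w s(o, v) = 0)
    (hxN : ∀ z : Fin n, z ≠ x → z ≠ p → z ≠ o → w s(x, z) = 0)
    (hyN : ∀ z : Fin n, z ≠ y → z ∉ A → z ≠ o → w s(y, z) = 0) :
    KNGood w A hA o b := by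
  haveI : ∀ v : Sym2 (Fin n) → unitInterval, IsProbabilityMeasure (prodBernoulli v) := fun v => inferInstance
  -- delete the hairs at `o`
  set w' : Sym2 (Fin n) → unitInterval := fun e => if ∃ q ∈ A, e = s(o, q) then 0 else w e with hw'
  refine knGood_of_deleteHairs w A hA o b ho ?_
  rw [← hw']
  have hpin : pinW w' {e : Sym2 (Fin n) | o ∈ e ∧ ¬ e.IsDiag} ∅ = pinW w {e : Sym2 (Fin n) | o ∈ e ∧ ¬ e.IsDiag} ∅ := by
    refine pinW_star_eq_of_eqOff w w' o fun e he => ?_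
    rw [hw']; simp only
    rw [if_neg]
    rintro ⟨q, hq, rfl⟩
    exact he ⟨Sym2.mem_mk_left o q, fun hd => ho ((Sym2.mk_isDiag_iff.1 hd) ▸ hq)⟩
  set u := pinW w {e : Sym2 (Fin n) | o ∈ e ∧ ¬ e.IsDiag} ∅ with hu
  have huoff : ∀ c d : Fin n, c ≠ o → d ≠ o → u s(c, d) = w s(c, d) := by
    intro c d hc hd
    have hmem : s(c, d) ∉ {e : Sym2 (Fin n) | o ∈ e ∧ ¬ e.IsDiag} := by
      rintro ⟨hoe, -⟩
      rcases Sym2.mem_iff.1 hoe with h | h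
      · exact hc h.symm
      · exact hd h.symm
    rw [hu, pinW_apply_of_not_mem w ∅ hmem]
  have huo : ∀ v : Fin n, v ≠ o → u s(v, o) = 0 := by
    intro v hv; rw [Sym2.eq_swap, hu]; exact pinW_star_mk w hv
  have hxpend : ∀ z : Fin n, z ≠ x → z ≠ p → u s(x, z) = 0 := by
    intro z hzx hzp
    by_cases hzo : z = o
    · rw [hzo]; exact huo x hxo
    · rw [huoff x z hxo hzo]; exact hxN z hzx hzp hzo
  have hyNu : ∀ z : Fin n, z ≠ y → z ∉ A → u s(y, z) = 0 := by
    intro z hzy hzA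
    by_cases hzo : z = o
    · rw [hzo]; exact huo y hyo
    · rw [huoff y z hyo hzo]; exact hyN z hzy hzA hzo
  -- Theorem 4 for the pendant stars `x`, `y` of `G − o`
  have hgoodx : KNGood u A hA x b := by
    refine KozmaNitzan2024_thm4_good u A hA x b hx fun q hqx hqA => hxpend q hqx (fun h => hqA (h ▸ hp))
  have hgoody : KNGood u A hA y b := KozmaNitzan2024_thm4_good u A hA y b hy fun q hqy hqA => hyNu q hqy hqA
  obtain ⟨a₀, ha₀, hmin⟩ := A.exists_min_image (fun a => (prodBernoulli u).real (openConn a b)) hA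
  have hGC := gc_of_singlePort u A hA x y p a₀ b hx hy hxy hp ha₀ hbx hby hxpend hyNu hmin
  exact knGood_series_of_gluing w' A hA o x y a₀ b ho hxo hyo hxy ha₀ hbo
    (fun v hvo hvx hvy => by
      rw [hw']; simp only
      by_cases hvA : v ∈ A
      · rw [if_pos ⟨v, hvA, rfl⟩]; rfl
      · rw [if_neg]
        · exact congrArg Subtype.val (hoN v hvo hvA hvx hvy)
        · rintro ⟨q, hq, hvq⟩
          exact hvA ((Sym2.congr_right.1 hvq) ▸ hq))
    (by rw [hpin]; exact hmin) (by rw [hpin]; exact hgoodx) (by rw [hpin]; exact hgoody) (by rw [hpin]; linarith [hGC])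

end KNGoodSinglePort

end Summit.CriticalPhenomena.PercolationContinuityZ3.Theorems

end
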